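import Summits.CriticalPhenomena.PercolationContinuityZ3.Theorems.PercNearOneGluingNoHeavyQuantThreeRootGenericOracle
import HarnessLib

/-!
# QUANT lane R8, T-DEC: THE THREE-TREE SIBLING GROUP WITH A HEAVY SINGLE — the COMPLEMENT of arm-1 g46's generic orientation
# (`q₃ ≥ Q₁₂` instead of `q₃ ≤ Q₁₂`) is a theorem given the oracle, AT THE TRUE FLOOR, when the light pair is balanced (arm-1 gen 52, architect)

builds on p205010 (kernel theorem, internal audit signed; external expert review pending)

Support file (`--supports stmt-CriticalPhenomena-4575`), QUANT lane seat prim-quant-arm-1 (gen 52, architect), rung R8 of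
`run/shared/lean/prim/quant/LADDER.md`; memo `run/shared/lean/prim/quant/prim-quant-arm-1-g52/ARCH-G52.md` §3.  Theorems only, standard axioms, no
sorries.  Companion of `…QuantThreeRootGenericCoupling/Step/Oracle` (arm-1 g46: pair `(1,2)` with hub `q₁ ≥ q₂`, single `3` with `q₃ ≤ Q = q₁+q₂−q₁q₂`,
generic re-gates, floor slack); same layout `gate_{q₁}ρ₁ ∗ gate_{q₂}ρ₂ ∗ gate_{q₃}ρ₃`, same tools (`lconv3_gate_expand` census-2 g71, `twoRoot` algebra
arm-1 g45, `convClosedT_holds`, `decAtT_mixture`, `decAtT_gate_of_sdec`, `treeBuiltN_gate_le`).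

THE IDENTITY (`threeRoot_gateCoupling_heavySingle`; ARCH-G52 §3, the "U-term root-pattern mixture").  When the SINGLE is the hub (`Q ≤ q₃`), the
two-root coupling of the single against the pair-compound `gate_Q(β)` (`β` = the pair conditioned on "some root open") reads
`gate_a(t₁∗t₂∗t₃) = w·[t₃ᵃ ∗ gate_a(t₁∗t₂)] + (1−w)·gate_{a q₃}(ρ₃ ∗ H)`, `w = (1−q₃)/(1−a q₃)`, `H = gate_{Q/q₃} β = (t₁∗t₂ − (1−q₃)δ₀)/q₃`, and the
law `H` — root marginals `qᵢ/q₃`, NEGATIVELY tilted against the product — is the EXPLICIT mixture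
  `H = q₃·(gate_{q₁/q₃}ρ₁ ∗ gate_{q₂/q₃}ρ₂) + κ₁·gate_{η₁}ρ₁ + κ₂·gate_{η₂}ρ₂`,
  `ηᵢ = (q₁R₁+q₂R₂)/(q₃Rᵢ)`, `κᵢ = qᵢ(1−q₃)Rᵢ/(q₁R₁+q₂R₂)` (`Rᵢ` the opened means; `q₃ + κ₁ + κ₂ = 1`),
of three forests with ONE COMMON MEAN `(q₁R₁+q₂R₂)/q₃` (the re-gated pair; box 1 alone at the raised gate `η₁`; box 2 alone at `η₂`).  With g45's split of
`gate_a(t₁∗t₂)` this gives FIVE components — P = `t₁ᵃ∗t₂ᵃ∗t₃ᵃ`, C = `gate_{aq₁}(ρ₁ ⊔ gate_{q₂/q₁}ρ₂) ∗ t₃ᵃ`, V = `gate_{aq₃}(gate_{q₁/q₃}ρ₁ ∗ gate_{q₂/q₃}ρ₂ ∗ ρ₃)`,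
V₁ = `gate_{aq₃}(gate_{η₁}ρ₁ ∗ ρ₃)`, V₂ = `gate_{aq₃}(gate_{η₂}ρ₂ ∗ ρ₃)` — every one a (product of) GATED FEWER-GATE FOREST(S) of mean exactly the target,
whose floors are AT LEAST the forest's true floor (`q₃·(qᵢ/q₃)·yᵢ = qᵢyᵢ`, `q₃ηᵢyᵢ ≥ qᵢyᵢ`): no slack condition.
THE THEOREM (`decAt_threeRootHeavySingle_of_opened`, `sdec_threeRootHeavySingle_of_opened` here; **`sdec_threeRootHeavySingle_of_oracle`** in the
sequel `…QuantThreeRootHeavySingleOracle`).  In the binder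
of `LawDec.GateStepN` (oracle: every `TreeBuiltN` law with `< n` nontrivial gates is SDEC), three opened trees `ρᵢ` (`TreeBuiltN yᵢ nᵢ Mᵢ ρᵢ`,
`n₁+n₂+n₃+3 ≤ n`, boxes 1, 2 non-empty), root gates `0 < q₂ ≤ q₁ < 1`, `0 < q₃ < 1` with the HEAVY-SINGLE condition `Q = q₁+q₂−q₁q₂ ≤ q₃` and the
BALANCE condition `q₁R₁ + q₂R₂ ≤ q₃·min(R₁, R₂)` (i.e. `ηᵢ ≤ 1`): the three-tree forest is SDEC at EVERY floor `0 < x ≤ min(q₁y₁, q₂y₂, q₃y₃)` — its true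
floor.  All six SDEC inputs are oracle calls (`nᵢ < n`; the opened pair `≤ n₁+n₂+1` gates; V's forest `≤ n₁+n₂+n₃+2`; V₁, V₂ `≤ nᵢ+n₃+1`).  Exact LP
(ARCH-G52 §3): for `k = 3` the heavy-single U-law `H` is a mixture of oracle-legal product forests IFF the balance condition holds, so this file is the
whole pattern-level content of that orientation; g46 (`q₃ ≤ Q`, generic, floor slack) and g47's bubble family are the other orientation.

HONEST STATUS.  A sub-family of the width-3 core; `GateStepN`, `SiblingStep`, `LightSiblingStep`, `FarTreeRow` remain OPEN; RATE class (log\*) and the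
honest sentence of `run/shared/lean/prim/quant/README.md` unchanged.  [this work]; layout/tools: prim-quant-arm-1 g45/g46, census-2 g71, lead g42 (this
lane).  Nothing here is a published result.  The gluing rows served [cite: KozmaNitzan2024, Conjecture 3 (p. 15)]; product measure
[cite: Grimmett1999, §1.3 p. 10].
-/

noncomputable section

namespace Summit.CriticalPhenomena.PercolationContinuityZ3.Theorems

namespace Quant

open Finset

namespace LawDec

/-! ### The identity -/

/-- the three-forest expansion with the THIRD root opened: `gate_{c₁}ρ₁ ∗ gate_{c₂}ρ₂ ∗ ρ₃` on the sub-forest convolutions. [this work] -/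
theorem lconv3_expand_open₃ (M₁ M₂ M₃ : ℕ) (ρ₁ ρ₂ ρ₃ : ℕ → ℝ) (c₁ c₂ : ℝ)
    (h₁M : ∀ h, M₁ < h → ρ₁ h = 0) (h₂M : ∀ h, M₂ < h → ρ₂ h = 0) (h₃M : ∀ h, M₃ < h → ρ₃ h = 0) (h : ℕ) :
    lconv (M₁ + M₂) M₃ (lconv M₁ M₂ (gate ρ₁ c₁) (gate ρ₂ c₂)) ρ₃ h
      = c₁ * c₂ * lconv (M₁ + M₂) M₃ (lconv M₁ M₂ ρ₁ ρ₂) ρ₃ h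
        + c₁ * (1 - c₂) * lconv M₁ M₃ ρ₁ ρ₃ h + (1 - c₁) * c₂ * lconv M₂ M₃ ρ₂ ρ₃ h
        + (1 - c₁) * (1 - c₂) * ρ₃ h := by
  have e := lconv3_gate_expand M₁ M₂ M₃ ρ₁ ρ₂ ρ₃ c₁ c₂ 1 h₁M h₂M h₃M h
  rw [gate_one] at e
  rw [e]
  ring

/-- **THE HEAVY-SINGLE THREE-ROOT GATE-COUPLING IDENTITY** (five components; see the module docstring for the reading).  An identity of rational
functions: the hypotheses only exclude vanishing denominators. [this work] -/
theorem threeRoot_gateCoupling_heavySingle (M₁ M₂ M₃ : ℕ) (ρ₁ ρ₂ ρ₃ : ℕ → ℝ) (q₁ q₂ q₃ a R₁ R₂ : ℝ)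
    (h₁M : ∀ h, M₁ < h → ρ₁ h = 0) (h₂M : ∀ h, M₂ < h → ρ₂ h = 0) (h₃M : ∀ h, M₃ < h → ρ₃ h = 0)
    (hq₁ : q₁ ≠ 0) (hq₃ : q₃ ≠ 0) (haq₃ : 1 - a * q₃ ≠ 0) (haq₁ : 1 - a * q₁ ≠ 0)
    (hR₁ : R₁ ≠ 0) (hR₂ : R₂ ≠ 0) (hm : q₁ * R₁ + q₂ * R₂ ≠ 0) (h : ℕ) :
    gate (lconv (M₁ + M₂) M₃ (lconv M₁ M₂ (gate ρ₁ q₁) (gate ρ₂ q₂)) (gate ρ₃ q₃)) a h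
      = ((1 - q₃) / (1 - a * q₃)) *
          (((1 - q₁) / (1 - a * q₁)) * lconv (M₁ + M₂) M₃ (lconv M₁ M₂ (gate ρ₁ (a * q₁)) (gate ρ₂ (a * q₂))) (gate ρ₃ (a * q₃)) h
            + (1 - (1 - q₁) / (1 - a * q₁))
              * lconv (M₁ + M₂) M₃ (gate (lconv M₁ M₂ ρ₁ (gate ρ₂ (q₂ / q₁))) (a * q₁)) (gate ρ₃ (a * q₃)) h)
        + (1 - (1 - q₃) / (1 - a * q₃)) *
          (q₃ * gate (lconv (M₁ + M₂) M₃ (lconv M₁ M₂ (gate ρ₁ (q₁ / q₃)) (gate ρ₂ (q₂ / q₃))) ρ₃) (a * q₃) h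
            + (1 - q₃) *
              ((q₁ * R₁ / (q₁ * R₁ + q₂ * R₂)) * gate (lconv M₁ M₃ (gate ρ₁ ((q₁ * R₁ + q₂ * R₂) / (q₃ * R₁))) ρ₃) (a * q₃) h
                + (1 - q₁ * R₁ / (q₁ * R₁ + q₂ * R₂))
                  * gate (lconv M₂ M₃ (gate ρ₂ ((q₁ * R₁ + q₂ * R₂) / (q₃ * R₂))) ρ₃) (a * q₃) h)) := by
  rw [gate_apply _ a h, lconv3_gate_expand M₁ M₂ M₃ ρ₁ ρ₂ ρ₃ q₁ q₂ q₃ h₁M h₂M h₃M h,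
    lconv3_gate_expand M₁ M₂ M₃ ρ₁ ρ₂ ρ₃ (a * q₁) (a * q₂) (a * q₃) h₁M h₂M h₃M h,
    -- C
    lconv_gate_left (M₁ + M₂) M₃ (lconv M₁ M₂ ρ₁ (gate ρ₂ (q₂ / q₁))) _ (a * q₁) (gate_eq_zero_of_top M₃ ρ₃ (a * q₃) h₃M) h,
    lconv3_expand_open₁ M₁ M₂ M₃ ρ₁ ρ₂ ρ₃ (q₂ / q₁) (a * q₃) h₁M h₂M h₃M h, gate_apply ρ₃ (a * q₃) h,
    -- V
    gate_apply (lconv (M₁ + M₂) M₃ (lconv M₁ M₂ (gate ρ₁ _) (gate ρ₂ _)) ρ₃) _ h,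
    lconv3_expand_open₃ M₁ M₂ M₃ ρ₁ ρ₂ ρ₃ (q₁ / q₃) (q₂ / q₃) h₁M h₂M h₃M h,
    -- V₁, V₂
    gate_apply (lconv M₁ M₃ (gate ρ₁ _) ρ₃) _ h, lconv_gate_left M₁ M₃ ρ₁ ρ₃ _ h₃M h,
    gate_apply (lconv M₂ M₃ (gate ρ₂ _) ρ₃) _ h, lconv_gate_left M₂ M₃ ρ₂ ρ₃ _ h₃M h]
  field_simp
  ring

/-! ### The heavy-single three-tree gate step -/

/-- **THE HEAVY-SINGLE THREE-TREE GATE STEP FROM THE OPENED FORESTS** (see the module docstring).  The means `Rᵢ`, the pair's union gate `Q` and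
the raised gates `η₁, η₂` are passed as parameters with their defining equations. [this work] -/
theorem decAt_threeRootHeavySingle_of_opened (y₁ y₂ y₃ w₁₂ v v₁ v₂ z q₁ q₂ q₃ a Q R₁ R₂ R₃ η₁ η₂ : ℝ) (M₁ M₂ M₃ : ℕ) (ρ₁ ρ₂ ρ₃ : ℕ → ℝ)
    (hy₁0 : 0 < y₁) (hy₁1 : y₁ < 1) (hy₂0 : 0 < y₂) (hy₂1 : y₂ < 1) (hy₃0 : 0 < y₃) (hy₃1 : y₃ < 1)
    (hw0 : 0 ≤ w₁₂) (hw1 : w₁₂ < 1) (hv0 : 0 ≤ v) (hv1 : v < 1) (hv₁0 : 0 ≤ v₁) (hv₁1 : v₁ < 1) (hv₂0 : 0 ≤ v₂) (hv₂1 : v₂ < 1)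
    (hq₂0 : 0 < q₂) (hq₂₁ : q₂ ≤ q₁) (hq₁1 : q₁ < 1) (hq₃0 : 0 < q₃) (hq₃1 : q₃ < 1)
    (hQ : Q = q₁ + q₂ - q₁ * q₂) (hQq₃ : Q ≤ q₃) (ha0 : 0 < a) (ha1 : a ≤ 1) (hz0 : 0 < z)
    (h₁0 : ∀ h, 0 ≤ ρ₁ h) (h₁M : ∀ h, M₁ < h → ρ₁ h = 0) (h₁1 : ∑ h ∈ Finset.range (M₁ + 1), ρ₁ h = 1)
    (hR₁ : ∑ h ∈ Finset.range (M₁ + 1), (h : ℝ) * ρ₁ h = R₁) (hta₁ : y₁ * (M₁ : ℝ) ≤ R₁) (hR₁0 : 0 < R₁)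
    (h₂0 : ∀ h, 0 ≤ ρ₂ h) (h₂M : ∀ h, M₂ < h → ρ₂ h = 0) (h₂1 : ∑ h ∈ Finset.range (M₂ + 1), ρ₂ h = 1)
    (hR₂ : ∑ h ∈ Finset.range (M₂ + 1), (h : ℝ) * ρ₂ h = R₂) (hta₂ : y₂ * (M₂ : ℝ) ≤ R₂) (hR₂0 : 0 < R₂)
    (h₃0 : ∀ h, 0 ≤ ρ₃ h) (h₃M : ∀ h, M₃ < h → ρ₃ h = 0) (h₃1 : ∑ h ∈ Finset.range (M₃ + 1), ρ₃ h = 1)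
    (hR₃ : ∑ h ∈ Finset.range (M₃ + 1), (h : ℝ) * ρ₃ h = R₃) (hta₃ : y₃ * (M₃ : ℝ) ≤ R₃)
    (hD₁ : SDEC y₁ M₁ ρ₁) (hD₂ : SDEC y₂ M₂ ρ₂) (hD₃ : SDEC y₃ M₃ ρ₃)
    -- the raised gates of the single-box components and the balance condition
    (hη₁ : η₁ = (q₁ * R₁ + q₂ * R₂) / (q₃ * R₁)) (hη₂ : η₂ = (q₁ * R₁ + q₂ * R₂) / (q₃ * R₂)) (hη₁1 : η₁ ≤ 1) (hη₂1 : η₂ ≤ 1)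
    -- the four smaller forests (oracle instances in `GateStepN`)
    (hG₁₂ : SDEC w₁₂ (M₁ + M₂) (lconv M₁ M₂ ρ₁ (gate ρ₂ (q₂ / q₁))))
    (htaG₁₂ : w₁₂ * ((M₁ + M₂ : ℕ) : ℝ) ≤ R₁ + q₂ / q₁ * R₂)
    (hV : SDEC v (M₁ + M₂ + M₃) (lconv (M₁ + M₂) M₃ (lconv M₁ M₂ (gate ρ₁ (q₁ / q₃)) (gate ρ₂ (q₂ / q₃))) ρ₃))
    (htaV : v * ((M₁ + M₂ + M₃ : ℕ) : ℝ) ≤ q₁ / q₃ * R₁ + q₂ / q₃ * R₂ + R₃)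
    (hV₁ : SDEC v₁ (M₁ + M₃) (lconv M₁ M₃ (gate ρ₁ η₁) ρ₃)) (htaV₁ : v₁ * ((M₁ + M₃ : ℕ) : ℝ) ≤ η₁ * R₁ + R₃)
    (hV₂ : SDEC v₂ (M₂ + M₃) (lconv M₂ M₃ (gate ρ₂ η₂) ρ₃)) (htaV₂ : v₂ * ((M₂ + M₃ : ℕ) : ℝ) ≤ η₂ * R₂ + R₃)
    (hz₁ : z ≤ a * q₁ * y₁) (hz₂ : z ≤ a * q₂ * y₂) (hz₃ : z ≤ a * q₃ * y₃) (hz₁₂ : z ≤ a * q₁ * w₁₂)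
    (hzv : z ≤ a * q₃ * v) (hzv₁ : z ≤ a * q₃ * v₁) (hzv₂ : z ≤ a * q₃ * v₂)
    (j : ℕ) (hj : j < M₁ + M₂ + M₃) :
    DECAt z j (M₁ + M₂ + M₃) (gate (lconv (M₁ + M₂) M₃ (lconv M₁ M₂ (gate ρ₁ q₁) (gate ρ₂ q₂)) (gate ρ₃ q₃)) a) := by
  -- elementary bounds
  have hq₁0 : 0 < q₁ := lt_of_lt_of_le hq₂0 hq₂₁
  have hq₂1 : q₂ < 1 := lt_of_le_of_lt hq₂₁ hq₁1
  have hQq₁ : q₁ ≤ Q := by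
    have t : 0 ≤ q₂ * (1 - q₁) := mul_nonneg hq₂0.le (by linarith)
    have e : Q - q₁ = q₂ * (1 - q₁) := by rw [hQ]; ring
    linarith
  have hQq₂ : q₂ ≤ Q := by
    have t : 0 ≤ q₁ * (1 - q₂) := mul_nonneg hq₁0.le (by linarith)
    have e : Q - q₂ = q₁ * (1 - q₂) := by rw [hQ]; ring
    linarith
  have hq₁q₃ : q₁ ≤ q₃ := hQq₁.trans hQq₃
  have hq₂q₃ : q₂ ≤ q₃ := hQq₂.trans hQq₃
  have haq₁0 : 0 < a * q₁ := mul_pos ha0 hq₁0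
  have haq₁1 : a * q₁ < 1 := mul_lt_one_aux ha1 hq₁0.le hq₁1
  have haq₂0 : 0 < a * q₂ := mul_pos ha0 hq₂0
  have haq₂1 : a * q₂ < 1 := mul_lt_one_aux ha1 hq₂0.le hq₂1
  have haq₃0 : 0 < a * q₃ := mul_pos ha0 hq₃0
  have haq₃1 : a * q₃ < 1 := mul_lt_one_aux ha1 hq₃0.le hq₃1
  have hr0 : 0 < q₂ / q₁ := div_pos hq₂0 hq₁0
  have hr1 : q₂ / q₁ ≤ 1 := by rw [div_le_one hq₁0]; exact hq₂₁
  have hc₁0 : 0 < q₁ / q₃ := div_pos hq₁0 hq₃0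
  have hc₁1 : q₁ / q₃ ≤ 1 := by rw [div_le_one hq₃0]; exact hq₁q₃
  have hc₂0 : 0 < q₂ / q₃ := div_pos hq₂0 hq₃0
  have hc₂1 : q₂ / q₃ ≤ 1 := by rw [div_le_one hq₃0]; exact hq₂q₃
  set m : ℝ := q₁ * R₁ + q₂ * R₂ with hmdef
  have hm0 : 0 < m := by rw [hmdef]; exact add_pos (mul_pos hq₁0 hR₁0) (mul_pos hq₂0 hR₂0)
  have hη₁0 : 0 < η₁ := by rw [hη₁]; exact div_pos hm0 (mul_pos hq₃0 hR₁0)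
  have hη₂0 : 0 < η₂ := by rw [hη₂]; exact div_pos hm0 (mul_pos hq₃0 hR₂0)
  have hz1 : z < 1 := by
    have : a * q₁ * y₁ < 1 := by
      have t := mul_lt_one_aux haq₁1.le hy₁0.le hy₁1
      linarith [t]
    linarith
  -- the mixture weights
  set w : ℝ := (1 - q₃) / (1 - a * q₃) with hwdef
  have hw0' : 0 ≤ w := div_nonneg (by linarith) (by linarith)
  have hw1' : w ≤ 1 := by
    rw [hwdef, div_le_one (by linarith)]
    have : a * q₃ ≤ 1 * q₃ := mul_le_mul_of_nonneg_right ha1 hq₃0.le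
    linarith
  set w₁₂' : ℝ := (1 - q₁) / (1 - a * q₁) with hw₁₂def
  have hw₁₂0 : 0 ≤ w₁₂' := div_nonneg (by linarith) (by linarith)
  have hw₁₂1 : w₁₂' ≤ 1 := by
    rw [hw₁₂def, div_le_one (by linarith)]
    have : a * q₁ ≤ 1 * q₁ := mul_le_mul_of_nonneg_right ha1 hq₁0.le
    linarith
  set κ : ℝ := q₁ * R₁ / m with hκdef
  have hκ0 : 0 ≤ κ := div_nonneg (mul_nonneg hq₁0.le hR₁0.le) hm0.le
  have hκ1 : κ ≤ 1 := by
    rw [hκdef, div_le_one hm0, hmdef]; linarith [mul_pos hq₂0 hR₂0]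
  obtain ⟨g₁0, g₁M, g₁1⟩ := gate_laws M₁ ρ₁ (a * q₁) haq₁0.le haq₁1.le h₁0 h₁M h₁1
  obtain ⟨g₂0, g₂M, g₂1⟩ := gate_laws M₂ ρ₂ (a * q₂) haq₂0.le haq₂1.le h₂0 h₂M h₂1
  obtain ⟨g₃0, g₃M, g₃1⟩ := gate_laws M₃ ρ₃ (a * q₃) haq₃0.le haq₃1.le h₃0 h₃M h₃1
  -- every gated box is DEC at every layer (floor z)
  have d₁ : ∀ j'', DECAtT z (a * q₁ * R₁) j'' M₁ (gate ρ₁ (a * q₁)) := by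
    intro j''
    have := decAtT_gate_of_sdec M₁ ρ₁ y₁ (a * q₁) z hy₁0.le haq₁0 haq₁1.le (mul_lt_one_aux haq₁1.le hy₁0.le hy₁1)
      hz₁ h₁0 h₁M h₁1 (by rw [hR₁]; exact hta₁) hD₁ j''
    rwa [hR₁] at this
  have d₂ : ∀ j'', DECAtT z (a * q₂ * R₂) j'' M₂ (gate ρ₂ (a * q₂)) := by
    intro j''
    have := decAtT_gate_of_sdec M₂ ρ₂ y₂ (a * q₂) z hy₂0.le haq₂0 haq₂1.le (mul_lt_one_aux haq₂1.le hy₂0.le hy₂1)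
      hz₂ h₂0 h₂M h₂1 (by rw [hR₂]; exact hta₂) hD₂ j''
    rwa [hR₂] at this
  have d₃ : ∀ j'', DECAtT z (a * q₃ * R₃) j'' M₃ (gate ρ₃ (a * q₃)) := by
    intro j''
    have := decAtT_gate_of_sdec M₃ ρ₃ y₃ (a * q₃) z hy₃0.le haq₃0 haq₃1.le (mul_lt_one_aux haq₃1.le hy₃0.le hy₃1)
      hz₃ h₃0 h₃M h₃1 (by rw [hR₃]; exact hta₃) hD₃ j''
    rwa [hR₃] at this
  -- component P: the product of the three scaled boxes — ConvClosedT twice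
  have hP : DECAtT z (a * (q₁ * R₁ + q₂ * R₂ + q₃ * R₃)) j (M₁ + M₂ + M₃)
      (lconv (M₁ + M₂) M₃ (lconv M₁ M₂ (gate ρ₁ (a * q₁)) (gate ρ₂ (a * q₂))) (gate ρ₃ (a * q₃))) := by
    have p0 : ∀ h, 0 ≤ lconv M₁ M₂ (gate ρ₁ (a * q₁)) (gate ρ₂ (a * q₂)) h := lconv_nonneg _ _ _ _ g₁0 g₂0
    have pM : ∀ h, M₁ + M₂ < h → lconv M₁ M₂ (gate ρ₁ (a * q₁)) (gate ρ₂ (a * q₂)) h = 0 :=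
      fun h hh => lconv_eq_zero _ _ _ _ h hh
    have p1 := sum_lconv M₁ M₂ _ _ g₁1 g₂1
    have pmean : ∑ h ∈ Finset.range (M₁ + M₂ + 1), (h : ℝ) * lconv M₁ M₂ (gate ρ₁ (a * q₁)) (gate ρ₂ (a * q₂)) h
        = a * q₁ * R₁ + a * q₂ * R₂ := by
      rw [sum_mul_lconv M₁ M₂ _ _ g₁1 g₂1, sum_mul_gate, sum_mul_gate, hR₁, hR₂]
    have pta : z * ((M₁ + M₂ : ℕ) : ℝ) ≤ a * q₁ * R₁ + a * q₂ * R₂ := by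
      have e1 := mul_le_mul_of_nonneg_right hz₁ (Nat.cast_nonneg M₁)
      have e1' := mul_le_mul_of_nonneg_left hta₁ haq₁0.le
      have e2 := mul_le_mul_of_nonneg_right hz₂ (Nat.cast_nonneg M₂)
      have e2' := mul_le_mul_of_nonneg_left hta₂ haq₂0.le
      have ee1 : a * q₁ * y₁ * (M₁ : ℝ) = a * q₁ * (y₁ * (M₁ : ℝ)) := by ring
      have ee2 : a * q₂ * y₂ * (M₂ : ℝ) = a * q₂ * (y₂ * (M₂ : ℝ)) := by ring
      push_cast
      linarith
    have pair : ∀ j'', DECAtT z (a * q₁ * R₁ + a * q₂ * R₂) j'' (M₁ + M₂)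
        (lconv M₁ M₂ (gate ρ₁ (a * q₁)) (gate ρ₂ (a * q₂))) := by
      have below : ∀ j'', j'' < M₁ + M₂ → DECAtT z (a * q₁ * R₁ + a * q₂ * R₂) j'' (M₁ + M₂)
          (lconv M₁ M₂ (gate ρ₁ (a * q₁)) (gate ρ₂ (a * q₂))) := fun j'' hj'' =>
        convClosedT_holds z (a * q₁ * R₁) (a * q₂ * R₂) M₁ M₂ j'' _ _ hz0 hz1 g₁0 g₁M g₁1 g₂0 g₂M g₂1 hj''
          (fun k _ _ => d₁ k) (fun k _ _ => d₂ k)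
      intro j''
      have := decAtT_all_of_below (M₁ + M₂) _ z hz0.le hz1 p0 pM p1 (by rw [pmean]; exact pta)
        (by rw [pmean]; exact below) j''
      rwa [pmean] at this
    have hC := convClosedT_holds z (a * q₁ * R₁ + a * q₂ * R₂) (a * q₃ * R₃) (M₁ + M₂) M₃ j _ _ hz0 hz1 p0 pM p1 g₃0 g₃M g₃1
      hj (fun k _ _ => pair k) (fun k _ _ => d₃ k)
    have e : a * q₁ * R₁ + a * q₂ * R₂ + a * q₃ * R₃ = a * (q₁ * R₁ + q₂ * R₂ + q₃ * R₃) := by ring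
    rwa [e] at hC
  -- component C: the gated opened pair beside the scaled single — oracle `hG₁₂` + ConvClosedT
  have hCc : DECAtT z (a * (q₁ * R₁ + q₂ * R₂ + q₃ * R₃)) j (M₁ + M₂ + M₃)
      (lconv (M₁ + M₂) M₃ (gate (lconv M₁ M₂ ρ₁ (gate ρ₂ (q₂ / q₁))) (a * q₁)) (gate ρ₃ (a * q₃))) := by
    obtain ⟨r0, rM, r1⟩ := gate_laws M₂ ρ₂ (q₂ / q₁) hr0.le hr1 h₂0 h₂M h₂1
    have o0 : ∀ h, 0 ≤ lconv M₁ M₂ ρ₁ (gate ρ₂ (q₂ / q₁)) h := lconv_nonneg _ _ _ _ h₁0 r0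
    have oM : ∀ h, M₁ + M₂ < h → lconv M₁ M₂ ρ₁ (gate ρ₂ (q₂ / q₁)) h = 0 := fun h hh => lconv_eq_zero _ _ _ _ h hh
    have o1 := sum_lconv M₁ M₂ _ _ h₁1 r1
    have omean : ∑ h ∈ Finset.range (M₁ + M₂ + 1), (h : ℝ) * lconv M₁ M₂ ρ₁ (gate ρ₂ (q₂ / q₁)) h = R₁ + q₂ / q₁ * R₂ := by
      rw [sum_mul_lconv M₁ M₂ _ _ h₁1 r1, sum_mul_gate, hR₁, hR₂]
    have dG : ∀ j'', DECAtT z (a * q₁ * (R₁ + q₂ / q₁ * R₂)) j'' (M₁ + M₂)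
        (gate (lconv M₁ M₂ ρ₁ (gate ρ₂ (q₂ / q₁))) (a * q₁)) := by
      intro j''
      have := decAtT_gate_of_sdec (M₁ + M₂) _ w₁₂ (a * q₁) z hw0 haq₁0 haq₁1.le (mul_lt_one_aux haq₁1.le hw0 hw1)
        hz₁₂ o0 oM o1 (by rw [omean]; exact htaG₁₂) hG₁₂ j''
      rwa [omean] at this
    obtain ⟨c0, cM, c1⟩ := gate_laws (M₁ + M₂) _ (a * q₁) haq₁0.le haq₁1.le o0 oM o1
    have hC := convClosedT_holds z (a * q₁ * (R₁ + q₂ / q₁ * R₂)) (a * q₃ * R₃) (M₁ + M₂) M₃ j _ _ hz0 hz1 c0 cM c1 g₃0 g₃M g₃1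
      hj (fun k _ _ => dG k) (fun k _ _ => d₃ k)
    have e : a * q₁ * (R₁ + q₂ / q₁ * R₂) + a * q₃ * R₃ = a * (q₁ * R₁ + q₂ * R₂ + q₃ * R₃) := by
      field_simp
    rwa [e] at hC
  -- component V: the single opened over the re-gated pair, under the merged gate `a q₃` (oracle `hV`)
  obtain ⟨m₁0, m₁M, m₁1⟩ := gate_laws M₁ ρ₁ (q₁ / q₃) hc₁0.le hc₁1 h₁0 h₁M h₁1
  obtain ⟨m₂0, m₂M, m₂1⟩ := gate_laws M₂ ρ₂ (q₂ / q₃) hc₂0.le hc₂1 h₂0 h₂M h₂1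
  have hVc : DECAtT z (a * (q₁ * R₁ + q₂ * R₂ + q₃ * R₃)) j (M₁ + M₂ + M₃)
      (gate (lconv (M₁ + M₂) M₃ (lconv M₁ M₂ (gate ρ₁ (q₁ / q₃)) (gate ρ₂ (q₂ / q₃))) ρ₃) (a * q₃)) := by
    have i1 := sum_lconv M₁ M₂ _ _ m₁1 m₂1
    have o0 : ∀ h, 0 ≤ lconv (M₁ + M₂) M₃ (lconv M₁ M₂ (gate ρ₁ (q₁ / q₃)) (gate ρ₂ (q₂ / q₃))) ρ₃ h :=
      lconv_nonneg _ _ _ _ (lconv_nonneg _ _ _ _ m₁0 m₂0) h₃0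
    have oM : ∀ h, M₁ + M₂ + M₃ < h → lconv (M₁ + M₂) M₃ (lconv M₁ M₂ (gate ρ₁ (q₁ / q₃)) (gate ρ₂ (q₂ / q₃))) ρ₃ h = 0 :=
      fun h hh => lconv_eq_zero _ _ _ _ h hh
    have o1 := sum_lconv (M₁ + M₂) M₃ _ _ i1 h₃1
    have omean : ∑ h ∈ Finset.range (M₁ + M₂ + M₃ + 1), (h : ℝ) *
        lconv (M₁ + M₂) M₃ (lconv M₁ M₂ (gate ρ₁ (q₁ / q₃)) (gate ρ₂ (q₂ / q₃))) ρ₃ h = q₁ / q₃ * R₁ + q₂ / q₃ * R₂ + R₃ := by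
      rw [sum_mul_lconv (M₁ + M₂) M₃ _ _ i1 h₃1, sum_mul_lconv M₁ M₂ _ _ m₁1 m₂1, sum_mul_gate, sum_mul_gate, hR₁, hR₂, hR₃]
    have := decAtT_gate_of_sdec (M₁ + M₂ + M₃) _ v (a * q₃) z hv0 haq₃0 haq₃1.le (mul_lt_one_aux haq₃1.le hv0 hv1)
      hzv o0 oM o1 (by rw [omean]; exact htaV) hV j
    rw [omean] at this
    have e : a * q₃ * (q₁ / q₃ * R₁ + q₂ / q₃ * R₂ + R₃) = a * (q₁ * R₁ + q₂ * R₂ + q₃ * R₃) := by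
      field_simp
    rwa [e] at this
  -- components V₁, V₂: one box alone at its raised gate beside the opened single, under `a q₃` (oracles `hV₁`, `hV₂`), tops lifted
  obtain ⟨e₁0, e₁M, e₁1⟩ := gate_laws M₁ ρ₁ η₁ hη₁0.le hη₁1 h₁0 h₁M h₁1
  obtain ⟨e₂0, e₂M, e₂1⟩ := gate_laws M₂ ρ₂ η₂ hη₂0.le hη₂1 h₂0 h₂M h₂1
  have hV₁c : DECAtT z (a * (q₁ * R₁ + q₂ * R₂ + q₃ * R₃)) j (M₁ + M₂ + M₃)
      (gate (lconv M₁ M₃ (gate ρ₁ η₁) ρ₃) (a * q₃)) := by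
    have o0 : ∀ h, 0 ≤ lconv M₁ M₃ (gate ρ₁ η₁) ρ₃ h := lconv_nonneg _ _ _ _ e₁0 h₃0
    have oM : ∀ h, M₁ + M₃ < h → lconv M₁ M₃ (gate ρ₁ η₁) ρ₃ h = 0 := fun h hh => lconv_eq_zero _ _ _ _ h hh
    have o1 := sum_lconv M₁ M₃ _ _ e₁1 h₃1
    have omean : ∑ h ∈ Finset.range (M₁ + M₃ + 1), (h : ℝ) * lconv M₁ M₃ (gate ρ₁ η₁) ρ₃ h = η₁ * R₁ + R₃ := by
      rw [sum_mul_lconv M₁ M₃ _ _ e₁1 h₃1, sum_mul_gate, hR₁, hR₃]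
    have := decAtT_gate_of_sdec (M₁ + M₃) _ v₁ (a * q₃) z hv₁0 haq₃0 haq₃1.le (mul_lt_one_aux haq₃1.le hv₁0 hv₁1)
      hzv₁ o0 oM o1 (by rw [omean]; exact htaV₁) hV₁ j
    rw [omean] at this
    have e : a * q₃ * (η₁ * R₁ + R₃) = a * (q₁ * R₁ + q₂ * R₂ + q₃ * R₃) := by
      rw [hη₁]; field_simp; rw [hmdef]; ring
    rw [e] at this
    exact decAtT_mono_top this (by omega)
  have hV₂c : DECAtT z (a * (q₁ * R₁ + q₂ * R₂ + q₃ * R₃)) j (M₁ + M₂ + M₃)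
      (gate (lconv M₂ M₃ (gate ρ₂ η₂) ρ₃) (a * q₃)) := by
    have o0 : ∀ h, 0 ≤ lconv M₂ M₃ (gate ρ₂ η₂) ρ₃ h := lconv_nonneg _ _ _ _ e₂0 h₃0
    have oM : ∀ h, M₂ + M₃ < h → lconv M₂ M₃ (gate ρ₂ η₂) ρ₃ h = 0 := fun h hh => lconv_eq_zero _ _ _ _ h hh
    have o1 := sum_lconv M₂ M₃ _ _ e₂1 h₃1
    have omean : ∑ h ∈ Finset.range (M₂ + M₃ + 1), (h : ℝ) * lconv M₂ M₃ (gate ρ₂ η₂) ρ₃ h = η₂ * R₂ + R₃ := by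
      rw [sum_mul_lconv M₂ M₃ _ _ e₂1 h₃1, sum_mul_gate, hR₂, hR₃]
    have := decAtT_gate_of_sdec (M₂ + M₃) _ v₂ (a * q₃) z hv₂0 haq₃0 haq₃1.le (mul_lt_one_aux haq₃1.le hv₂0 hv₂1)
      hzv₂ o0 oM o1 (by rw [omean]; exact htaV₂) hV₂ j
    rw [omean] at this
    have e : a * q₃ * (η₂ * R₂ + R₃) = a * (q₁ * R₁ + q₂ * R₂ + q₃ * R₃) := by
      rw [hη₂]; field_simp; rw [hmdef]; ring
    rw [e] at this
    exact decAtT_mono_top this (by omega)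
  -- the mixture
  have inner₁ := decAtT_mixture w₁₂' hw₁₂0 hw₁₂1 hP hCc
  have inner₃ := decAtT_mixture κ hκ0 hκ1 hV₁c hV₂c
  have inner₂ := decAtT_mixture q₃ hq₃0.le hq₃1.le hVc inner₃
  have mix := decAtT_mixture w hw0' hw1' inner₁ inner₂
  -- the identity
  have e : gate (lconv (M₁ + M₂) M₃ (lconv M₁ M₂ (gate ρ₁ q₁) (gate ρ₂ q₂)) (gate ρ₃ q₃)) a
      = fun h => w * (w₁₂' * lconv (M₁ + M₂) M₃ (lconv M₁ M₂ (gate ρ₁ (a * q₁)) (gate ρ₂ (a * q₂))) (gate ρ₃ (a * q₃)) h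
            + (1 - w₁₂') * lconv (M₁ + M₂) M₃ (gate (lconv M₁ M₂ ρ₁ (gate ρ₂ (q₂ / q₁))) (a * q₁)) (gate ρ₃ (a * q₃)) h)
          + (1 - w) * (q₃ * gate (lconv (M₁ + M₂) M₃ (lconv M₁ M₂ (gate ρ₁ (q₁ / q₃)) (gate ρ₂ (q₂ / q₃))) ρ₃) (a * q₃) h
            + (1 - q₃) * (κ * gate (lconv M₁ M₃ (gate ρ₁ η₁) ρ₃) (a * q₃) h
              + (1 - κ) * gate (lconv M₂ M₃ (gate ρ₂ η₂) ρ₃) (a * q₃) h)) := by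
    funext h
    rw [hwdef, hw₁₂def, hκdef, hmdef, hη₁, hη₂]
    exact threeRoot_gateCoupling_heavySingle M₁ M₂ M₃ ρ₁ ρ₂ ρ₃ q₁ q₂ q₃ a R₁ R₂ h₁M h₂M h₃M hq₁0.ne' hq₃0.ne'
      (sub_pos.2 haq₃1).ne' (sub_pos.2 haq₁1).ne' hR₁0.ne' hR₂0.ne' (by rw [← hmdef]; exact hm0.ne') h
  -- the mean of the doubly gated three-tree law
  obtain ⟨t₁0, t₁M, t₁1⟩ := gate_laws M₁ ρ₁ q₁ hq₁0.le hq₁1.le h₁0 h₁M h₁1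
  obtain ⟨t₂0, t₂M, t₂1⟩ := gate_laws M₂ ρ₂ q₂ hq₂0.le hq₂1.le h₂0 h₂M h₂1
  obtain ⟨t₃0, t₃M, t₃1⟩ := gate_laws M₃ ρ₃ q₃ hq₃0.le hq₃1.le h₃0 h₃M h₃1
  have hEmean : ∑ h ∈ Finset.range (M₁ + M₂ + M₃ + 1), (h : ℝ) *
      gate (lconv (M₁ + M₂) M₃ (lconv M₁ M₂ (gate ρ₁ q₁) (gate ρ₂ q₂)) (gate ρ₃ q₃)) a h = a * (q₁ * R₁ + q₂ * R₂ + q₃ * R₃) := by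
    rw [sum_mul_gate, sum_mul_lconv (M₁ + M₂) M₃ _ _ (sum_lconv M₁ M₂ _ _ t₁1 t₂1) t₃1, sum_mul_lconv M₁ M₂ _ _ t₁1 t₂1,
      sum_mul_gate, sum_mul_gate, sum_mul_gate, hR₁, hR₂, hR₃]
  rw [decAt_iff_decAtT, hEmean, e]
  exact mix

/-- **COROLLARY (SDEC form).**  Same data; conclusion: the three-tree forest `gate_{q₁}ρ₁ ∗ gate_{q₂}ρ₂ ∗ gate_{q₃}ρ₃` is SDEC at every floor
`0 < x` with `x ≤ qᵢyᵢ` (i = 1,2,3), `x ≤ q₁w₁₂`, `x ≤ q₃v`, `x ≤ q₃v₁`, `x ≤ q₃v₂`. [this work] -/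
theorem sdec_threeRootHeavySingle_of_opened (y₁ y₂ y₃ w₁₂ v v₁ v₂ x q₁ q₂ q₃ Q R₁ R₂ R₃ η₁ η₂ : ℝ) (M₁ M₂ M₃ : ℕ) (ρ₁ ρ₂ ρ₃ : ℕ → ℝ)
    (hy₁0 : 0 < y₁) (hy₁1 : y₁ < 1) (hy₂0 : 0 < y₂) (hy₂1 : y₂ < 1) (hy₃0 : 0 < y₃) (hy₃1 : y₃ < 1)
    (hw0 : 0 ≤ w₁₂) (hw1 : w₁₂ < 1) (hv0 : 0 ≤ v) (hv1 : v < 1) (hv₁0 : 0 ≤ v₁) (hv₁1 : v₁ < 1) (hv₂0 : 0 ≤ v₂) (hv₂1 : v₂ < 1)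
    (hq₂0 : 0 < q₂) (hq₂₁ : q₂ ≤ q₁) (hq₁1 : q₁ < 1) (hq₃0 : 0 < q₃) (hq₃1 : q₃ < 1)
    (hQ : Q = q₁ + q₂ - q₁ * q₂) (hQq₃ : Q ≤ q₃) (hx0 : 0 < x)
    (h₁0 : ∀ h, 0 ≤ ρ₁ h) (h₁M : ∀ h, M₁ < h → ρ₁ h = 0) (h₁1 : ∑ h ∈ Finset.range (M₁ + 1), ρ₁ h = 1)
    (hR₁ : ∑ h ∈ Finset.range (M₁ + 1), (h : ℝ) * ρ₁ h = R₁) (hta₁ : y₁ * (M₁ : ℝ) ≤ R₁) (hR₁0 : 0 < R₁)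
    (h₂0 : ∀ h, 0 ≤ ρ₂ h) (h₂M : ∀ h, M₂ < h → ρ₂ h = 0) (h₂1 : ∑ h ∈ Finset.range (M₂ + 1), ρ₂ h = 1)
    (hR₂ : ∑ h ∈ Finset.range (M₂ + 1), (h : ℝ) * ρ₂ h = R₂) (hta₂ : y₂ * (M₂ : ℝ) ≤ R₂) (hR₂0 : 0 < R₂)
    (h₃0 : ∀ h, 0 ≤ ρ₃ h) (h₃M : ∀ h, M₃ < h → ρ₃ h = 0) (h₃1 : ∑ h ∈ Finset.range (M₃ + 1), ρ₃ h = 1)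
    (hR₃ : ∑ h ∈ Finset.range (M₃ + 1), (h : ℝ) * ρ₃ h = R₃) (hta₃ : y₃ * (M₃ : ℝ) ≤ R₃)
    (hD₁ : SDEC y₁ M₁ ρ₁) (hD₂ : SDEC y₂ M₂ ρ₂) (hD₃ : SDEC y₃ M₃ ρ₃)
    (hη₁ : η₁ = (q₁ * R₁ + q₂ * R₂) / (q₃ * R₁)) (hη₂ : η₂ = (q₁ * R₁ + q₂ * R₂) / (q₃ * R₂)) (hη₁1 : η₁ ≤ 1) (hη₂1 : η₂ ≤ 1)
    (hG₁₂ : SDEC w₁₂ (M₁ + M₂) (lconv M₁ M₂ ρ₁ (gate ρ₂ (q₂ / q₁))))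
    (htaG₁₂ : w₁₂ * ((M₁ + M₂ : ℕ) : ℝ) ≤ R₁ + q₂ / q₁ * R₂)
    (hV : SDEC v (M₁ + M₂ + M₃) (lconv (M₁ + M₂) M₃ (lconv M₁ M₂ (gate ρ₁ (q₁ / q₃)) (gate ρ₂ (q₂ / q₃))) ρ₃))
    (htaV : v * ((M₁ + M₂ + M₃ : ℕ) : ℝ) ≤ q₁ / q₃ * R₁ + q₂ / q₃ * R₂ + R₃)
    (hV₁ : SDEC v₁ (M₁ + M₃) (lconv M₁ M₃ (gate ρ₁ η₁) ρ₃)) (htaV₁ : v₁ * ((M₁ + M₃ : ℕ) : ℝ) ≤ η₁ * R₁ + R₃)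
    (hV₂ : SDEC v₂ (M₂ + M₃) (lconv M₂ M₃ (gate ρ₂ η₂) ρ₃)) (htaV₂ : v₂ * ((M₂ + M₃ : ℕ) : ℝ) ≤ η₂ * R₂ + R₃)
    (hx₁ : x ≤ q₁ * y₁) (hx₂ : x ≤ q₂ * y₂) (hx₃ : x ≤ q₃ * y₃) (hx₁₂ : x ≤ q₁ * w₁₂)
    (hxv : x ≤ q₃ * v) (hxv₁ : x ≤ q₃ * v₁) (hxv₂ : x ≤ q₃ * v₂) :
    SDEC x (M₁ + M₂ + M₃) (lconv (M₁ + M₂) M₃ (lconv M₁ M₂ (gate ρ₁ q₁) (gate ρ₂ q₂)) (gate ρ₃ q₃)) := by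
  intro a ha0 ha1 j hj
  have b₁ := mul_le_mul_of_nonneg_left hx₁ ha0.le
  have b₂ := mul_le_mul_of_nonneg_left hx₂ ha0.le
  have b₃ := mul_le_mul_of_nonneg_left hx₃ ha0.le
  have b₁₂ := mul_le_mul_of_nonneg_left hx₁₂ ha0.le
  have bv := mul_le_mul_of_nonneg_left hxv ha0.le
  have bv₁ := mul_le_mul_of_nonneg_left hxv₁ ha0.le
  have bv₂ := mul_le_mul_of_nonneg_left hxv₂ ha0.le
  exact decAt_threeRootHeavySingle_of_opened y₁ y₂ y₃ w₁₂ v v₁ v₂ (a * x) q₁ q₂ q₃ a Q R₁ R₂ R₃ η₁ η₂ M₁ M₂ M₃ ρ₁ ρ₂ ρ₃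
    hy₁0 hy₁1 hy₂0 hy₂1 hy₃0 hy₃1 hw0 hw1 hv0 hv1 hv₁0 hv₁1 hv₂0 hv₂1 hq₂0 hq₂₁ hq₁1 hq₃0 hq₃1 hQ hQq₃ ha0 ha1 (mul_pos ha0 hx0)
    h₁0 h₁M h₁1 hR₁ hta₁ hR₁0 h₂0 h₂M h₂1 hR₂ hta₂ hR₂0 h₃0 h₃M h₃1 hR₃ hta₃ hD₁ hD₂ hD₃ hη₁ hη₂ hη₁1 hη₂1 hG₁₂ htaG₁₂ hV htaV
    hV₁ htaV₁ hV₂ htaV₂ (by linarith) (by linarith) (by linarith) (by linarith) (by linarith) (by linarith) (by linarith) j hj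

end LawDec

end Quant

end Summit.CriticalPhenomena.PercolationContinuityZ3.Theorems
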